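import Literature.IUT.HodgeTheaters.GenuineFKitOfBadLocalTempered
import Literature.IUT.HodgeTheaters.BadLocalFrobenioidOfKitsBirat
import Literature.AnabelianGeometry.EtaleTheta.Discharge.Sec3Cor38iiiFSMWeak
import Literature.AlgebraicGeometry.Frobenioids.EquivalencePreStepsQuasiIsotropic
import Literature.AlgebraicGeometry.Frobenioids.BiratLocalization
import Literature.AnabelianGeometry.SemiGraphs.CosetCategoriesFSM
import HarnessLib

/-!
# [IUTchI] Example 3.2 (ii) `BiratFromF` with the [FrdI] Thm. 3.4 (ii) input DISCHARGED BY NAME, at the assembly,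
# at the genuine datum, and AT THE MERGE RECORD with tempered (m1) (`MergeInputs.ofRest`)

S. Mochizuki, *Inter-universal Teichmüller theory I*, kurims manuscript (May 2020), Example 3.2 (ii) p. 70: «the
birationalization `ℱ÷_v := ℱ̲_v^birat` [which] may be reconstructed category-theoretically from `ℱ̲_v` [cf. [FrdI],
Corollary 4.10; [EtTh], Proposition 5.1]» [claim: Mochizuki2012, status: disputed] (D-0012 claim key, series status
DISPUTED; PROOF-ONLY composition BY NAME; nothing of the series is asserted; no side is taken on [IUTchIII] Cor. 3.12).
S. Mochizuki, *The geometry of Frobenioids I*, Kyushu J. Math. **62** (2008), Thm. 3.4 (ii) p. 62 («`Ψ` preserves …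
co-angular pre-steps»), Cor. 4.10 p. 90 [cite: MochizukiFrdI2008, Thm. 3.4 (ii) p.62]; S. Mochizuki, *The étale theta
function …*, Publ. RIMS **45** (2009), Thm. 3.7 (i) p. 79 (a tempered Frobenioid is of isotropic, hence quasi-isotropic,
type) [cite: MochizukiEtTh2009, Thm 3.7 p.79].

STATE BEFORE THIS FILE.  abc-iut-L5-t2's `BadLocalFrobenioidOfKitsBirat.lean` (p492628) proves the typed (ii)
sentence `BiratFromF` for every tempered-side input over an [EtTh] Def. 3.6 tempered Frobenioid `Fr` whose `ℱ÷_v` IS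
abc-iut-L1's birationalization `PreFrobenioid.Birat Fr.toElem hF hsq` with `birat = toBirat` (`hb`), MODULO the
[FrdI] Thm. 3.4 (ii) input displayed as `hΨ` («every self-equivalence of `ℱ̲_v` preserves co-angular pre-steps»); the
L5 binder census (MERGE-DOSSIER-C §2, CONE-L5-STATUS v2.10 row `IUTchI:Ex3.2(ii)`) lists {`hF`, `hsq`, `hb`, `hΨ`} with
`hΨ` «FACT-class, no F-id of record».

WHAT THIS FILE PROVES (proof-only; no definition, instance, notation or `sorry`).
* §1 `BadLocalFrobenioid.isCoAngularPreStep_map_temperedSelfEquivalence` — **`hΨ` IS A THEOREM** for every [EtTh]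
  Def. 3.6 tempered Frobenioid (weak [FrdI] monoid vocabulary) over a base of FSM-type, in particular over
  `𝒟_v = CosetCat Π_v` (`…_cosetCat`): abc-iut-L1-t13's `FrdI.isCoAngularPreStep_map_of_quasiIsotropic_of_isOfFSMType`
  ([FrdI] Thm. 3.4 (ii), FSM form; the 2008 wording `FrdI.Thm34ii_holds` is FACT-LIST F-0711, a theorem) fed by
  abc-iut-L2's `TemperedFrobenioid.data_isOfQuasiIsotropicType_weak` ([EtTh] Thm. 3.7 (i)) and abc-iut-L1's
  `CosetCat.isOfFSMType` ([FrdII] Ex. 1.3 (i)); only `hF` ([FrdI] Thm. 5.2 (ii) at `Fr`) is consumed.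
* §2 `BadLocalFrobenioid.biratFromF_ofKits_of_birat_equiv` — (ii) at the assembly `ofKits … K` modulo {`hF`, `hb`} ONLY,
  with `hb` in the EQUIVALENCE-INVARIANT form of the printed clause «`ℱ÷_v := ℱ̲_v^birat`»: `ℱ÷_v` is equivalent to the
  birationalization compatibly with `ℱ̲_v → ℱ÷_v` (`∃ Φ : Fbirat ≌ Birat …, K.birat ⋙ Φ.functor ≅ toBirat`); `hsq` is
  discharged by abc-iut-L1's `PreFrobenioid.hasBiratSquares_of_isFrobenioid` ([FrdI] Prop. 1.11 (vii)) and `hΨ` by §1;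
  `…_of_birat_eq_toBirat'` = p492628's statement with `hΨ` removed.
* §3 `InitialThetaData.biratFromF_badLocalFrobenioidAt_of_birat_equiv` (GENUINE datum `K_v̲ = K_w`, ∀ `T`) and
  `…AtDoubleUnderline_of_birat_equiv` (at the [EtTh] §1 group datum).
* §4 **AT THE MERGE RECORD** (abc-iut-L5-t2 ★ p496697 `genuineFKitOfBadLocal`, (m1) := tempered Frobenioid + rest,
  `MergeInputs.ofRest` p498213): `InitialThetaData.biratFromF_frobeniusBadAt_ofRest` — (ii) `BiratFromF` at
  `D.frobeniusBadAt B (MergeInputs.ofRest D B m2 Rr m4 geomTFG) x hx` for EVERY rest-form input, modulo EXACTLY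
  {`hF` : `(Rr x hx).Fr` is a Frobenioid ([FrdI] Thm. 5.2 (ii) at the L2 input — the binder shared with (iii)/(vi)(d)),
  `hb` : `(Rr x hx).Fbirat` IS (≌) the birationalization of `ℱ̲_v`, compatibly}; and the joint
  `ex32_ii_iii_frobeniusBadAt_ofRest` = (ii) ∧ (iii) with the [EtTh] Cor. 3.8 (ii) bundle of `cFromF_frobeniusBadAt_ofRest`.
BINDER CENSUS of §4: {`D`, `B`, `m2`, `Rr`, `m4`, `geomTFG`, `x`, `hx`} ∪ {`hF`, `hb`} (∪ {`hnd`, `hds`, `h5`, `hR`} in the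
joint form); FACT unnamed 0; LAW outside the displayed binders 0.  HONEST: `hb` has no inhabitant in the tree today
(row «E32ii-BIRAT-REAL»: a rest input whose `ℱ÷_v` is built AS the birationalization is def-bearing work of record);
the FOUNDATIONS-BOUNDARY HOLD on the genuine (m1) (GAP G-L5-EX32I-1) is untouched; typed ≠ inhabited ≠ proved.
-/

noncomputable section

namespace Literature.IUT.HodgeTheaters

open CategoryTheory Literature.AnabelianGeometry.SemiGraphs Literature.AlgebraicGeometry.Frobenioids
open Literature.AlgebraicGeometry.Frobenioids.PadicFrd Literature.AnabelianGeometry.EtaleTheta Topology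

universe u₀ v₀ u v w

/-! ### §1 [FrdI] Thm. 3.4 (ii) BY NAME: self-equivalences of a tempered Frobenioid preserve co-angular pre-steps -/

namespace BadLocalFrobenioid

section Thm34ii

variable {D₀ : Type u₀} [Category.{v₀} D₀] {T' : RealifiedDivisorMonoids (D₀ := D₀) treeMonoidVocabWeak.{w}}
  {Dv : Type u} [Category.{v} Dv] {VD : FrdICatStub.{u, v, w} Dv}

/-- **The [FrdI] Thm. 3.4 (ii) input `hΨ` of (ii) IS A THEOREM**: for an [EtTh] Def. 3.6 tempered Frobenioid `Fr` (weak
[FrdI] vocabulary) over a base of FSM-type which is a Frobenioid (`hF`, [FrdI] Thm. 5.2 (ii)), every self-equivalence of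
`ℱ̲_v = Fr.category` carries co-angular pre-steps to co-angular pre-steps — abc-iut-L1-t13's FSM form of Thm. 3.4 (ii)
(`FrdI.isCoAngularPreStep_map_of_quasiIsotropic_of_isOfFSMType`), its quasi-isotropic-type antecedent supplied by [EtTh]
Thm. 3.7 (i) (`TemperedFrobenioid.data_isOfQuasiIsotropicType_weak`). [cite: MochizukiFrdI2008, Thm. 3.4 (ii) p.62] -/
theorem isCoAngularPreStep_map_temperedSelfEquivalence (Fr : TemperedFrobenioid T' Dv VD)
    (hF : PreFrobenioid.IsFrobenioid Fr.toElem) (hD : IsOfFSMType Dv) (e : Fr.category ≌ Fr.category)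
    ⦃A B : Fr.category⦄ (f : A ⟶ B) (hf : PreFrobenioid.IsCoAngularPreStep Fr.toElem f) :
    PreFrobenioid.IsCoAngularPreStep Fr.toElem (e.functor.map f) :=
  FrdI.isCoAngularPreStep_map_of_quasiIsotropic_of_isOfFSMType hF hF (Fr.data_isOfQuasiIsotropicType_weak hF)
    (Fr.data_isOfQuasiIsotropicType_weak hF) hD e hf

end Thm34ii

/-! ### §2 (ii) `BiratFromF` at the assembly, modulo {`hF`, `hb`} only -/

section Assembly

variable {p : ℕ} [Fact p.Prime] (l : ℕ) (d : GaloisValDatum.{0} p) {P : Type} [Group P] [TopologicalSpace P]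
  [IsTopologicalGroup P] (T : BadLocalGroupDatum d.Gal P) (q qroot : intNonzero d.k) (hpow : qroot ^ (2 * l) = q)
  (hq : ¬ IsUnit qroot) {D₀ : Type u₀} [Category.{v₀} D₀]
  {T' : RealifiedDivisorMonoids (D₀ := D₀) treeMonoidVocabWeak.{0}} {VD : FrdICatStub.{0, 0, 0} T.Dv}

/-- `hΨ` over the REAL base `𝒟_v = CosetCat Π_v` (FSM-type by abc-iut-L1's `CosetCat.isOfFSMType`, [FrdII] Ex. 1.3 (i)).
[cite: MochizukiFrdI2008, Thm. 3.4 (ii) p.62] -/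
theorem isCoAngularPreStep_map_temperedSelfEquivalence_cosetCat (Fr : TemperedFrobenioid T' T.Dv VD)
    (hF : PreFrobenioid.IsFrobenioid Fr.toElem) (e : Fr.category ≌ Fr.category)
    ⦃A B : Fr.category⦄ (f : A ⟶ B) (hf : PreFrobenioid.IsCoAngularPreStep Fr.toElem f) :
    PreFrobenioid.IsCoAngularPreStep Fr.toElem (e.functor.map f) :=
  isCoAngularPreStep_map_temperedSelfEquivalence Fr hF (CosetCat.isOfFSMType (G := P)) e f hf

/-- **p492628's (ii) with `hΨ` REMOVED**: `BiratFromF` for the assembly `ofKits` over an [EtTh] tempered Frobenioid whose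
`ℱ÷_v` IS `Birat Fr.toElem hF hsq` with `ℱ̲_v → ℱ÷_v = toBirat` (`hb`), modulo `hF` only ([FrdI] Thm. 3.4 (ii) by §1).
([IUTchI] Ex 3.2 (ii) p.70) [claim: Mochizuki2012, status: disputed] -/
theorem biratFromF_ofKits_of_birat_eq_toBirat' (Fr : TemperedFrobenioid T' T.Dv VD)
    (hF : PreFrobenioid.IsFrobenioid Fr.toElem) (hsq : PreFrobenioid.HasBiratSquares Fr.toElem)
    {Cv : Type} [Category.{0} Cv] (K : TemperedThetaInput d T hq Fr.category (PreFrobenioid.Birat Fr.toElem hF hsq) Cv)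
    (hb : K.birat = PreFrobenioid.toBirat Fr.toElem hF hsq) :
    (ofKits l d T q qroot hpow hq K).BiratFromF :=
  biratFromF_ofKits_of_birat_eq_toBirat l d T q qroot hpow hq Fr hF hsq K hb
    (fun e _ _ f hf => isCoAngularPreStep_map_temperedSelfEquivalence_cosetCat d T Fr hF e f hf)

/-- **[IUTchI] Ex. 3.2 (ii) `BiratFromF` at the assembly, modulo {`hF`, `hb`} ONLY**, `hb` in the equivalence-invariant
form of «`ℱ÷_v := ℱ̲_v^birat`»: the input's `ℱ÷_v` is EQUIVALENT to abc-iut-L1's birationalization of `ℱ̲_v`, compatibly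
with `ℱ̲_v → ℱ÷_v` and the natural functor `toBirat`.  Every self-equivalence `e` of `ℱ̲_v` then lifts: `e^birat :=
Birat.mapOfEquiv … e` ([FrdI] Cor. 4.10, an equivalence, `toBirat ⋙ e^birat ≅ e ⋙ toBirat`) conjugated by the given
equivalence `Φ`; `hsq` by [FrdI] Prop. 1.11 (vii), `hΨ` by §1. ([IUTchI] Ex 3.2 (ii) p.70) [claim: Mochizuki2012, status: disputed] -/
theorem biratFromF_ofKits_of_birat_equiv (Fr : TemperedFrobenioid T' T.Dv VD)
    (hF : PreFrobenioid.IsFrobenioid Fr.toElem) (hsq : PreFrobenioid.HasBiratSquares Fr.toElem)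
    {Fbirat : Type} [Category.{0} Fbirat] {Cv : Type} [Category.{0} Cv]
    (K : TemperedThetaInput d T hq Fr.category Fbirat Cv)
    (hb : ∃ Φ : Fbirat ≌ PreFrobenioid.Birat Fr.toElem hF hsq,
      Nonempty (K.birat ⋙ Φ.functor ≅ PreFrobenioid.toBirat Fr.toElem hF hsq)) :
    (ofKits l d T q qroot hpow hq K).BiratFromF := by
  intro e
  obtain ⟨Φ, ⟨ι⟩⟩ := hb
  have hΨ : ∀ (e : Fr.category ≌ Fr.category) ⦃A B : Fr.category⦄ (f : A ⟶ B),
      PreFrobenioid.IsCoAngularPreStep Fr.toElem f → PreFrobenioid.IsCoAngularPreStep Fr.toElem (e.functor.map f) :=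
    fun e _ _ f hf => isCoAngularPreStep_map_temperedSelfEquivalence_cosetCat d T Fr hF e f hf
  haveI := PreFrobenioid.Birat.mapOfEquiv_isEquivalence hF hsq hF hsq e (hΨ e) (hΨ e.symm)
  let E : PreFrobenioid.Birat Fr.toElem hF hsq ≌ PreFrobenioid.Birat Fr.toElem hF hsq :=
    (PreFrobenioid.Birat.mapOfEquiv hF hsq hF hsq e (hΨ e)).asEquivalence
  -- `toBirat ⋙ Φ⁻¹ ≅ birat`
  have ι' : PreFrobenioid.toBirat Fr.toElem hF hsq ⋙ Φ.inverse ≅ K.birat :=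
    (Functor.isoWhiskerRight ι Φ.inverse).symm ≪≫ Functor.associator _ _ _ ≪≫ Functor.isoWhiskerLeft K.birat Φ.unitIso.symm ≪≫
      K.birat.rightUnitor
  refine ⟨(Φ.trans E).trans Φ.symm, ⟨?_⟩⟩
  change K.birat ⋙ (Φ.functor ⋙ E.functor) ⋙ Φ.inverse ≅ e.functor ⋙ K.birat
  exact (Functor.associator _ _ _).symm ≪≫ Functor.isoWhiskerRight (Functor.associator _ _ _).symm Φ.inverse ≪≫
    Functor.isoWhiskerRight (Functor.isoWhiskerRight ι E.functor) Φ.inverse ≪≫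
    Functor.isoWhiskerRight (PreFrobenioid.Birat.mapOfEquivFac hF hsq hF hsq e (hΨ e)) Φ.inverse ≪≫
    Functor.associator _ _ _ ≪≫ Functor.isoWhiskerLeft e.functor ι'

end Assembly

end BadLocalFrobenioid

/-! ### §3 At the genuine datum and at the [EtTh] §1 group datum -/

section Datum

open _root_.NumberField _root_.IsDedekindDomain

variable {F K Fbar : Type} [Field F] [NumberField F] [Field K] [NumberField K] [Algebra F K]
  [Field Fbar] [Algebra F Fbar] [Algebra K Fbar] [IsScalarTower F K Fbar] {E : WeierstrassCurve F}
  [E.IsElliptic] {l : ℕ} {Pb : BadPlacePredicates K} (D : InitialThetaData F K Fbar E l Pb)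
  {v : FinitePlace F} (hv : v ∈ D.VFbad) (w : HeightOneSpectrum (𝓞 K)) [w.asIdeal.LiesOver v.maximalIdeal.asIdeal]
  (p : ℕ) [Fact p.Prime] (hw : ((p : ℕ) : 𝓞 K) ∈ w.asIdeal)
  {D₀ : Type u₀} [Category.{v₀} D₀] {T' : RealifiedDivisorMonoids (D₀ := D₀) treeMonoidVocabWeak.{0}}

namespace InitialThetaData

/-- **[IUTchI] Ex. 3.2 (ii) `BiratFromF` AT THE GENUINE DATUM** (`K_v̲ = K_w`, genuine `q_v̲`, `q̲_v̲`, `𝒞⊢_v̲`), for every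
input group datum `T`, every [EtTh] tempered Frobenioid `Fr` on `𝒟_v̲` which is a Frobenioid (`hF`) and every
tempered-side input whose `ℱ÷_v` is (≌) THE birationalization of `Fr.category` compatibly with `ℱ̲_v → ℱ÷_v` (`hb`);
NO Thm. 3.4 (ii) binder. ([IUTchI] Ex 3.2 (ii) p.70) [claim: Mochizuki2012, status: disputed] -/
theorem biratFromF_badLocalFrobenioidAt_of_birat_equiv {P : Type} [Group P] [TopologicalSpace P]
    [IsTopologicalGroup P] (T : BadLocalGroupDatum (GaloisValDatum.ofPlace K p w hw).Gal P)
    {VD : FrdICatStub.{0, 0, 0} T.Dv} (Fr : TemperedFrobenioid T' T.Dv VD) (hF : PreFrobenioid.IsFrobenioid Fr.toElem)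
    (hsq : PreFrobenioid.HasBiratSquares Fr.toElem) {Fbirat : Type} [Category.{0} Fbirat] {Cv : Type} [Category.{0} Cv]
    (Kt : TemperedThetaInput (GaloisValDatum.ofPlace K p w hw) T (D.qRootAt_not_isUnit hv w p hw) Fr.category Fbirat Cv)
    (hb : ∃ Φ : Fbirat ≌ PreFrobenioid.Birat Fr.toElem hF hsq,
      Nonempty (Kt.birat ⋙ Φ.functor ≅ PreFrobenioid.toBirat Fr.toElem hF hsq)) :
    (D.badLocalFrobenioidAt hv w p hw T Kt).BiratFromF :=
  BadLocalFrobenioid.biratFromF_ofKits_of_birat_equiv l _ T _ _ _ _ Fr hF hsq Kt hb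

/-- **p492628's genuine-datum (ii) with `hΨ` REMOVED** (`ℱ÷_v = Birat Fr.toElem hF hsq`, `birat = toBirat`).
([IUTchI] Ex 3.2 (ii) p.70) [claim: Mochizuki2012, status: disputed] -/
theorem biratFromF_badLocalFrobenioidAt_of_birat_eq_toBirat' {P : Type} [Group P] [TopologicalSpace P]
    [IsTopologicalGroup P] (T : BadLocalGroupDatum (GaloisValDatum.ofPlace K p w hw).Gal P)
    {VD : FrdICatStub.{0, 0, 0} T.Dv} (Fr : TemperedFrobenioid T' T.Dv VD) (hF : PreFrobenioid.IsFrobenioid Fr.toElem)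
    (hsq : PreFrobenioid.HasBiratSquares Fr.toElem) {Cv : Type} [Category.{0} Cv]
    (Kt : TemperedThetaInput (GaloisValDatum.ofPlace K p w hw) T (D.qRootAt_not_isUnit hv w p hw) Fr.category
      (PreFrobenioid.Birat Fr.toElem hF hsq) Cv)
    (hb : Kt.birat = PreFrobenioid.toBirat Fr.toElem hF hsq) :
    (D.badLocalFrobenioidAt hv w p hw T Kt).BiratFromF :=
  BadLocalFrobenioid.biratFromF_ofKits_of_birat_eq_toBirat' l _ T _ _ _ _ Fr hF hsq Kt hb

variable {S : ThetaSetting p} {ES : S.EtaleThetaData} (dGL : S.toTemperedCurve.GroupLevelData) (hS2 : S.Sec2Hyps)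
  (C : ES.DoubleUnderline l) (ι : ↥S.GK ≃ₜ* (GaloisValDatum.ofPlace K p w hw).Gal)

/-- **[IUTchI] Ex. 3.2 (ii) `BiratFromF` AT THE [EtTh] §1 GROUP DATUM** (`Π_v̲ := Π^tp_{X̲̲}` of the double-underline curve),
for every [EtTh] tempered Frobenioid `Fr` on `𝒟_v̲ = CosetCat Π^tp_{X̲̲}` which is a Frobenioid and every tempered-side
input with `ℱ÷_v ≌ ℱ̲_v^birat` compatibly (`hb`); NO Thm. 3.4 (ii) binder.
([IUTchI] Ex 3.2 (ii) p.70) [claim: Mochizuki2012, status: disputed] -/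
theorem biratFromF_badLocalFrobenioidAtDoubleUnderline_of_birat_equiv
    {VD : FrdICatStub.{0, 0, 0} (badGroupDatumOfDoubleUnderline w p hw dGL hS2 C ι).Dv}
    (Fr : TemperedFrobenioid T' (badGroupDatumOfDoubleUnderline w p hw dGL hS2 C ι).Dv VD)
    (hF : PreFrobenioid.IsFrobenioid Fr.toElem) (hsq : PreFrobenioid.HasBiratSquares Fr.toElem)
    {Fbirat : Type} [Category.{0} Fbirat] {Cv : Type} [Category.{0} Cv]
    (Kt : TemperedThetaInput (GaloisValDatum.ofPlace K p w hw) (badGroupDatumOfDoubleUnderline w p hw dGL hS2 C ι)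
      (D.qRootAt_not_isUnit hv w p hw) Fr.category Fbirat Cv)
    (hb : ∃ Φ : Fbirat ≌ PreFrobenioid.Birat Fr.toElem hF hsq,
      Nonempty (Kt.birat ⋙ Φ.functor ≅ PreFrobenioid.toBirat Fr.toElem hF hsq)) :
    (D.badLocalFrobenioidAtDoubleUnderline hv w p hw dGL hS2 C ι Kt).BiratFromF :=
  D.biratFromF_badLocalFrobenioidAt_of_birat_equiv hv w p hw _ Fr hF hsq Kt hb

end InitialThetaData

end Datum

/-! ### §4 AT THE MERGE RECORD with tempered (m1): `MergeInputs.ofRest` -/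

section MergeRecord

open _root_.NumberField _root_.IsDedekindDomain

variable {F K Fbar : Type} [Field F] [NumberField F] [Field K] [NumberField K] [Algebra F K]
  [Field Fbar] [Algebra F Fbar] [Algebra K Fbar] {E : WeierstrassCurve F}
  [E.IsElliptic] {l : ℕ} {Pb : BadPlacePredicates K} (D : InitialThetaData F K Fbar E l Pb)
  (B : ∀ v, v ∈ D.indexCopyBad → D.BadPairAt v)
  (m2 : ∀ x (hx : x ∈ D.indexCopyBad), BadLocalGroupDatum (D.GalAt x (D.not_mem_arc_of_mem_bad hx)) ↥(B x hx).H)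
  (Rr : ∀ x (hx : x ∈ D.indexCopyBad), D.BadTemperedRest B x hx (m2 x hx)) (m4 : InitialThetaData.RealifiedGlobalSide)
  (geomTFG : D.geom.extF.GeomTFG) (x : D.IndexCopy) (hx : x ∈ D.indexCopyBad)

namespace InitialThetaData

/-- **[IUTchI] Ex. 3.2 (ii) AT THE MERGE RECORD with tempered (m1)**: «`ℱ÷_v := ℱ̲_v^birat` may be reconstructed
category-theoretically from `ℱ̲_v`» — `BiratFromF` — HOLDS at `frobeniusBadAt B (ofRest …) x hx` for EVERY rest-form input,
modulo EXACTLY {`hF` : the L2 tempered Frobenioid `(Rr x hx).Fr` is a Frobenioid ([FrdI] Thm. 5.2 (ii)), `hb` : the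
input's `ℱ÷_v` is (≌) its birationalization, compatibly with `ℱ̲_v → ℱ÷_v`}; the [FrdI] Thm. 3.4 (ii) input is a theorem
(§1), the birat-squares input is [FrdI] Prop. 1.11 (vii).  The (ii) twin of `cFromF_frobeniusBadAt_ofRest` (p498213).
([IUTchI] Ex 3.2 (ii) p.70) [claim: Mochizuki2012, status: disputed] -/
theorem biratFromF_frobeniusBadAt_ofRest [Fact (D.primeAt x (D.not_mem_arc_of_mem_bad hx)).Prime]
    (hF : letI := (Rr x hx).catD₀; PreFrobenioid.IsFrobenioid (Rr x hx).Fr.toElem)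
    (hb : letI := (Rr x hx).catD₀; letI := (Rr x hx).catFbirat
      ∃ Φ : (Rr x hx).Fbirat ≌
          PreFrobenioid.Birat (Rr x hx).Fr.toElem hF (PreFrobenioid.hasBiratSquares_of_isFrobenioid hF),
        Nonempty ((Rr x hx).R.birat ⋙ Φ.functor ≅
          PreFrobenioid.toBirat (Rr x hx).Fr.toElem hF (PreFrobenioid.hasBiratSquares_of_isFrobenioid hF))) :
    (D.frobeniusBadAt B (MergeInputs.ofRest D B m2 Rr m4 geomTFG) x hx).BiratFromF :=
  haveI := D.liesOver_placeBelow x hx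
  haveI := D.isScalarTower
  letI := (Rr x hx).catD₀; letI := (Rr x hx).catFbirat
  D.biratFromF_badLocalFrobenioidAt_of_birat_equiv (D.placeBelow_mem_VFbad x hx) (D.specAt x _) (D.primeAt x _)
    (D.primeAt_mem x _) (m2 x hx) (Rr x hx).Fr hF (PreFrobenioid.hasBiratSquares_of_isFrobenioid hF)
    (Rr x hx).R.toInput hb

/-- **[IUTchI] Ex. 3.2 (ii) ∧ (iii) JOINTLY at the merge record with tempered (m1)**: `BiratFromF` modulo {`hF`, `hb`} and
`CFromF` modulo abc-iut-L1-t12's [EtTh] Cor. 3.8 (ii) bundle {`hnd`, `hds`, `hF`, `h5`, `hR`} (`cFromF_frobeniusBadAt_ofRest`,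
p498213) — ONE shared `hF`. ([IUTchI] Ex 3.2 (ii)(iii) pp.70-71) [claim: Mochizuki2012, status: disputed] -/
theorem ex32_ii_iii_frobeniusBadAt_ofRest [Fact (D.primeAt x (D.not_mem_arc_of_mem_bad hx)).Prime]
    (hF : letI := (Rr x hx).catD₀; PreFrobenioid.IsFrobenioid (Rr x hx).Fr.toElem)
    (hb : letI := (Rr x hx).catD₀; letI := (Rr x hx).catFbirat
      ∃ Φ : (Rr x hx).Fbirat ≌
          PreFrobenioid.Birat (Rr x hx).Fr.toElem hF (PreFrobenioid.hasBiratSquares_of_isFrobenioid hF),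
        Nonempty ((Rr x hx).R.birat ⋙ Φ.functor ≅
          PreFrobenioid.toBirat (Rr x hx).Fr.toElem hF (PreFrobenioid.hasBiratSquares_of_isFrobenioid hF)))
    (hnd : letI := (Rr x hx).catD₀
      ∀ (A : (m2 x hx).Dvᵒᵖ) (f : A ⟶ A), treeMonoidVocabWeak.{0}.IsNonDilating ((Rr x hx).Fr.Φ.carrier A) ((Rr x hx).Fr.Φ.pull f))
    (hds : letI := (Rr x hx).catD₀
      ∀ (A : (m2 x hx).Dv) (α : Aut (Over.forget A)),
      (∀ (B' : Over A) (y : (Rr x hx).Fr.divisorMonoid.obj (Opposite.op B'.left)),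
        Literature.AlgebraicGeometry.Frobenioids.pull (Rr x hx).Fr.divisorMonoid (α.hom.app B') y = y) → α = 1)
    (h5 : letI := (Rr x hx).catD₀; (Rr x hx).Fr.BsFldPreStepLimitCriterion (PreFrobenioidData.perfection hF))
    (hR : letI := (Rr x hx).catD₀; (Rr x hx).Fr.Remark363) :
    (D.frobeniusBadAt B (MergeInputs.ofRest D B m2 Rr m4 geomTFG) x hx).BiratFromF ∧
      (D.frobeniusBadAt B (MergeInputs.ofRest D B m2 Rr m4 geomTFG) x hx).CFromF :=
  ⟨D.biratFromF_frobeniusBadAt_ofRest B m2 Rr m4 geomTFG x hx hF hb,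
    D.cFromF_frobeniusBadAt_ofRest B m2 Rr m4 geomTFG x hx hnd hds hF h5 hR⟩

end InitialThetaData

end MergeRecord

end Literature.IUT.HodgeTheaters

end
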